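import Literature.AlgebraicGeometry.Motives.HodgeStructureLefschetzGroupEigenspaceSplitting
import Literature.AlgebraicGeometry.Deligne1982.InvolutionPairedWeightSpaces
import HarnessLib

/-!
# `S(H)(K) ≅ ∏_{χ ∈ Φ} GL(V_{K,χ})` by restriction, for `E_φ = ι(F)` with a NON-TRIVIAL Rosati involution `σ` and `Φ` a
# set of representatives of the pairs `{χ, χ ∘ σ}` (a CM type) — Milne 1999 §2, type IV with `E = K` a CM field (`d = 1`):
# "`S(A)_{/k^al} = ∏_σ S_σ` where `S_σ ≈ Aut(V₁) ≈ GL`", obtained from Remark 2.2 ("`α ↦ α|V₁ : U(φ)_Ω → GL(V₁)` is an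
# isomorphism") on the abstract polarized `ℚ`-Hodge structure, on `K`-points for every field `K` admitting all embeddings of `F`

[topic AlgebraicGeometry/Motives]

Layer `Literature/AlgebraicGeometry/Motives`, lane `lit-hodgefound` (Track 2 foundations library; seat `lit-hodgefound-p34`,
generation 21, FILE 2 of the self-proposed row g21-#1 of `run/shared/lean/pub/lit-hodgefound/SKELETON.md`). The TRANSPORT
to the Hodge-structure carrier of the pure-algebra file `Deligne1982/InvolutionPairedWeightSpaces` (g21-#1: Milne's Remark 2.2
on Deligne's split-étale carrier — `formUnitaryGroup`, `restrictHom`, `contragredient`, `formUnitaryGroupEquiv`), along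
`Motives/HodgeStructureLefschetzGroupEigenspaceSplitting` (g20-#2: the blocks `V_{K,χ} = EndAction.eigenspaceBaseChange K A χ`
ARE Deligne's `weightSpace`, `EndAction.weightSpace_eq_eigenspaceBaseChange`; `actL a = ι(a)_K`, `actL_eq_baseChange_ι`) and
`Motives/HodgeStructureLefschetzGroupPoints` (g18-#1: `S(H)(K) = Q.lefschetzGroupBaseChange K`). THEOREMS plus three
definitions WITH BODIES (`glConjMulEquiv` — transport of `GL` along a linear equivalence —, and the two isomorphisms
`Polarization.lefschetzGroupBaseChangeEquivBlocks` / `…EquivEigenBlocks`); no named fact (net debt `0`).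

CARRIER. `H : HodgeStructure V n` (any weight), `Q : Polarization H`, a number field `F` acting by Hodge endomorphisms
`A : EndAction H F` with `E_φ = ι(F)` (`hE : H.endAlg = A.ι.range` — Milne's simple type IV with `E = K` a CM field, or
type I when `σ = 1`), the Rosati condition `Q(ι(a)v, w) = Q(v, ι(σ a)w)` for an involution `σ` of `F` (`hros`, `hσ : σσ = 1`),
a field `K ⊇ ℚ` with an injective family `τ : S → (F →ₐ[ℚ] K)` of `card S = [F:ℚ]` embeddings (`hτ`, `hcard`), the index
involution `κ : S → S` with `τ_{κ s} = τₛ ∘ σ` (`hκ`), and a set `Φ ⊆ S` of representatives of its orbits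
(`hΦ₁ : ∀ s, s ∈ Φ ∨ κ s ∈ Φ`, `hΦ₂ : ∀ s ∈ Φ, κ s ∉ Φ` — for `σ` = complex conjugation of a CM field: `τ(Φ)` is a CM type).

## The source, verbatim

J. S. Milne, *Lefschetz classes on abelian varieties*, Duke Math. J. **96** (1999) 639–675 [Milne1999LefschetzClasses]
(held `paper:doi-10-1215-s0012-7094-99-09620-5`; Duke page = folio + 638). §1 p. 644 L18: "`S(A)(R) = {γ ∈ C(A) ⊗_k R |
γ†γ = 1}`". §2 p. 646 L38–L42: "There exists a unique skew-Hermitian pairing of `L`-modules `φ : V(A) × V(A) → L` such that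
`Tr_{L/k} ∘ φ = e_D`. From the uniqueness of `φ`, one deduces that an `L`-linear automorphism of `V(A)` fixes `φ` if and only
if it fixes `e_D`." **Remark 2.2** (p. 647 L48 – p. 648 L7): "Let `φ` be a nondegenerate skew-Hermitian form on a
`k′`-vector space `V` relative to the nontrivial involution of `k′` fixing `k` […] `V ⊗_k Ω = V₁ ⊕ V₂` […] Then
`φ|V₁ × V₁ = 0 = φ|V₂ × V₂`, and there is a nondegenerate `Ω`-bilinear form `φ₁ : V₁ × V₂ → Ω` […] Therefore, the map
`α ↦ α|V₁ : U(φ)_Ω → GL(V₁)` is an isomorphism, and the representation of `U(φ)_Ω` on `V ⊗_k Ω` becomes the direct sum of the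
representation of `GL(V₁)` on `V₁` (standard representation) and the representation of `GL(V₁)` on `V₂` (contragredient of
the standard representation)." p. 651 L36–L81 (type IV): "`K ⊗_ℚ k^al = ∏_σ K_σ`, `K_σ = E ⊗_{F,σ} k^al` […]
`(V(A), φ) ⊗_k F ⊗_ℚ k^al = ⊕ (V_σ, φ_σ)` […] Using Remarks 2.2, 2.3, and 2.4, we find that, for each `σ`, there exist
compatible isomorphisms `E_σ → Ē`, `(V_σ, φ_σ) → (V̄, φ̄)` […] Moreover, `S(A)_{/k^al} = ∏ S_σ` where
`S_σ ≈ Aut_{M_d(k^al)}(V₁) ≈ GL_{fg/d}(k^al)`. The representation of `S_σ` on `V_σ` is isomorphic to the direct sum of `d`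
copies of the standard representation of `GL_{fg/d}(k^al)` and `d` copies of its contragredient." (Here `d = 1`, `E = K`:
each `σ : F → k^al` has the two extensions `χ, χ ∘ ι` to the CM field, `V_σ = V_χ ⊕ V_{χι}`, `S_σ ≈ GL(V_χ)`.)

## What is PROVED

* §0 `glConjMulEquiv e : GL(M) ≃* GL(N)` (`g ↦ e g e⁻¹`, by `rfl` on elements).
* §1 `Polarization.form_swap_eq_negOnePow_mul` (`Q(w, v) = (-1)ⁿ Q(v, w)`) and **`Polarization.lefschetzGroupBaseChange_eq_formUnitaryGroup`**:
  for `E_φ = ι(F)`, `S(H)(K) = U(φ)(K)` — the tree's `Q.lefschetzGroupBaseChange K` EQUALS `Deligne1982.formUnitaryGroup F K Q.form`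
  for the `F`-module structure `a • v = ι(a)v` (Milne p. 646: fixing `φ` ⟺ fixing `e_D`).
* §2 **`Polarization.lefschetzGroupBaseChangeEquivBlocks`**: `S(H)(K) ≃* ∏_{s ∈ Φ} GL(V_{K,τₛ})` (blocks typed as Deligne's
  `weightSpace ℚ F K V τ s`), `γ ↦ (γ|V_{K,τₛ})_{s∈Φ}` (`coe_…_apply`), = `MulEquiv.subgroupCongr` of §1 followed by g21-#1's
  `formUnitaryGroupEquiv` (whose inverse extends a family of blocks by the contragredients `ᵗg⁻¹` on the partners `V_{K,τₛ∘σ}`);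
  **`Polarization.lefschetzGroupBaseChangeEquivEigenBlocks`**: the same with the blocks typed as the tree's
  `A.eigenspaceBaseChange K (τ s)` (`coe_…_apply`: it IS restriction); **`Polarization.exists_unique_mem_lefschetzGroupBaseChange_restrict_eq`**
  (every family of automorphisms of the `V_{K,τₛ}`, `s ∈ Φ`, is the family of blocks of a unique `γ ∈ S(H)(K)` — "`S_σ ≈ GL`");
  `Polarization.eq_of_forall_eqOn_eigenspaceBaseChange` (injectivity on `Φ`); `Polarization.eqOn_eigenspaceBaseChange_comp_of_eqOn`
  (`γ|V_{K,χ}` determines `γ|V_{K,χ∘σ}` — "contragredient of the standard representation");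
  `EndAction.finrank_eigenspaceBaseChange_eq_finrank_eigenspaceBaseChange_comp` (`dim V_{K,χ} = dim V_{K,χ∘σ}`, "`V₂ = V₁^∨`");
  `Polarization.isPerfPair_baseChange_form_eigenspaceBaseChange` (`Q_K : V_{K,χ} × V_{K,χ∘σ} → K` is a perfect pairing — "`φ₁`
  nondegenerate").

NOT here: the existence of `τ`, `κ`, `Φ` (for `K` containing a normal closure of `F`, `τ` = all embeddings, `κ = (· ∘ σ)`, `Φ` a
CM type when `σ` is the complex conjugation of a CM field `F` — the tree's CM-type files, BY NAME); the division-algebra case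
`d > 1` of type IV (Remarks 2.3/2.4, Morita) and types II/III (a second form `φ₂`); `S(H)` as a group scheme / non-split `K`;
the explicit contragredient formula on the HS carrier (it is g21-#1's `restrictHom_ι_eq_contragredient` read through §1, not
restated); the Mumford–Tate side (`Hg(H)(K) ≤ S(H)(K)`, the tree's `hodgeGroupBaseChange_le_lefschetzGroupBaseChange`).
Related, BY NAME: `Motives/HodgeStructureLefschetzGroupEigenspaceSplitting` §4–§5 (type I, `σ = 1`: `S(H)(K) ≅ ∏_σ Sp(V_{K,σ})`
unbundled), `Motives/HodgeStructureLefschetzGroupTraceTransfer` (Milne's `φ`, "fixes `φ` iff fixes `e_D`" with `U(φ)`/`Sp(φ)`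
readings), `Milne1999/LefschetzCentraliserCM` and `Milne1999/SpecialLefschetzGroupInvariantsGLPowers` (the same groups on
`H¹(A(ℂ); ℂ)` for CM abelian varieties, diagonal / matrix form).

## References

* [Milne1999LefschetzClasses] J. S. Milne, *Lefschetz classes on abelian varieties*, Duke Math. J. 96 (1999) 639–675, §1 p. 644,
  §2 p. 646, Remark 2.2 (pp. 647–648), p. 651 (type IV).
* [Deligne1982HodgeCycles] P. Deligne, *Hodge cycles on abelian varieties*, LNM 900 (1982), §4 (proof of Prop. 4.4: the
  decomposition `H¹_B ⊗ ℂ = ⊕_σ H¹_{B,σ}`; proof of Lemma 4.6: the `φ`-orthogonal decomposition).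
-/

noncomputable section

open scoped TensorProduct
open Function Module

namespace Literature.AlgebraicGeometry.Motives

/-! ## §0 Conjugating automorphism groups along a linear equivalence -/

section GLConj

universe uR uM uN

variable {R : Type uR} [CommSemiring R] {M : Type uM} [AddCommMonoid M] [Module R M]
  {N : Type uN} [AddCommMonoid N] [Module R N]

/-- **`GL(M) ≃* GL(N)` along `e : M ≃ N`**, `g ↦ e ∘ g ∘ e⁻¹` (transport of structure; the tree's `glConjHom` is the
one-directional version). [folklore] -/
def glConjMulEquiv (e : M ≃ₗ[R] N) : (M ≃ₗ[R] M) ≃* (N ≃ₗ[R] N) where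
  toFun g := e.symm.trans (g.trans e)
  invFun g := e.trans (g.trans e.symm)
  left_inv g := LinearEquiv.ext fun x => by simp
  right_inv g := LinearEquiv.ext fun x => by simp
  map_mul' g h := LinearEquiv.ext fun x => by simp [LinearEquiv.mul_apply]

end GLConj

namespace HodgeStructure

universe u uK

variable {V : Type u} [AddCommGroup V] [Module ℚ V] {n : ℤ} {H : HodgeStructure V n}
variable {F : Type*} [Field F] [NumberField F]
variable (K : Type uK) [Field K] [Algebra ℚ K] (A : EndAction H F) {S : Type*} (τ : S → (F →ₐ[ℚ] K))
variable (Q : Polarization H) (σ : F ≃ₐ[ℚ] F)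

/-! ## §1 `S(H)(K) = U(φ)(K)`: for `E_φ = ι(F)`, the Lefschetz group on `K`-points IS the unitary group of §3 of
`Deligne1982/InvolutionPairedWeightSpaces` for `(k, k′, L, V, ψ) = (ℚ, F, K, V, Q)` -/

/-- The polarization form is `(-1)ⁿ`-symmetric: `Q(w, v) = (-1)ⁿ Q(v, w)` (the field `Polarization.flip_form`, elementwise).
[cite: Milne1999LefschetzClasses, §1 p. 642 ("a skew-symmetric pairing e_D")] -/
theorem Polarization.form_swap_eq_negOnePow_mul (v w : V) :
    Q.form w v = (((n.negOnePow : ℤˣ) : ℤ) : ℚ) * Q.form v w := by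
  have h : Q.form w v = ((n.negOnePow : ℤˣ) : ℤ) • Q.form v w := LinearMap.congr_fun₂ Q.flip_form v w
  rw [h, zsmul_eq_mul]

/-- **`S(H)(K) = U(φ)(K)`**: for `E_φ = ι(F)`, an automorphism of `K ⊗ V` commutes with `E_φ ⊗ K` iff it commutes with
Deligne's action `actL` of `F` (`actL a = ι(a)_K`), so Milne's `S(A)(K) = {γ ∈ C(A) ⊗ K | γ†γ = 1}` is the group
`formUnitaryGroup F K Q.form` of `Deligne1982/InvolutionPairedWeightSpaces` ("an `L`-linear automorphism of `V(A)` fixes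
`φ` if and only if it fixes `e_D`"). [cite: Milne1999LefschetzClasses, §1 p. 644 L18 and §2 p. 646 L38–L42] -/
theorem Polarization.lefschetzGroupBaseChange_eq_formUnitaryGroup (hE : H.endAlg = A.ι.range) :
    letI : Module F V := Module.compHom V (A.ι : F →+* Module.End ℚ V)
    haveI : IsScalarTower ℚ F V := A.isScalarTower_compHom
    Q.lefschetzGroupBaseChange K = Deligne1982.formUnitaryGroup F K Q.form := by
  letI : Module F V := Module.compHom V (A.ι : F →+* Module.End ℚ V)
  haveI : IsScalarTower ℚ F V := A.isScalarTower_compHom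
  ext γ
  rw [Q.mem_lefschetzGroupBaseChange_iff, Deligne1982.mem_formUnitaryGroup_iff]
  refine and_congr_left fun _ => ⟨fun h a x => ?_, fun h a x => ?_⟩
  · rw [A.actL_eq_baseChange_ι K a]
    exact (h ⟨A.ι a, A.map_F_le a⟩ x).symm
  · have ha : (a : Module.End ℚ V) ∈ A.ι.range := by rw [← hE]; exact a.2
    obtain ⟨b, hb⟩ := (AlgHom.mem_range A.ι).mp ha
    have h' := h b x
    rw [A.actL_eq_baseChange_ι K b, hb] at h'
    exact h'.symm

/-! ## §2 Milne's type IV (`d = 1`) on points: `S(H)(K) ≅ ∏_{s ∈ Φ} GL(V_{K,τₛ})` by restriction, for a set `Φ` of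
representatives of the pairs `{χ, χ ∘ σ}` (a "CM type" for `σ` = complex conjugation) -/

section Splitting

variable [Fintype S] [Module.Finite ℚ V] (κ : S → S) (Φ : Finset S)

/-- **`S(H)(K) ≃* ∏_{s ∈ Φ} GL(V_{K,τₛ})`, `γ ↦ (γ|V_{K,τₛ})_{s ∈ Φ}`** — for `E_φ = ι(F)`, the Rosati condition
`Q(ι(a)v, w) = Q(v, ι(σa)w)` for an involution `σ` of `F`, a field `K` admitting all `[F:ℚ]` embeddings `τₛ` of `F`,
the index involution `κ` (`τ_{κ s} = τₛ ∘ σ`) and a set `Φ ⊆ S` of representatives of its (free) orbits — Milne: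
"`S(A)_{/k^al} = ∏_σ S_σ` where `S_σ ≈ Aut(V₁) ≈ GL`" (type IV with `E` a CM FIELD), obtained from Remark 2.2 pair by pair
("`α ↦ α|V₁ : U(φ)_Ω → GL(V₁)` is an isomorphism"). The blocks are Deligne's `weightSpace ℚ F K V τ s` (= `V_{K,τₛ}`,
`EndAction.weightSpace_eq_eigenspaceBaseChange`); the inverse extends a family of blocks by the contragredients on the
partners `V_{K,τₛ∘σ}`. [cite: Milne1999LefschetzClasses, §2 Remark 2.2 (p. 647 L69 – p. 648 L5) and p. 651 L72–L81 ("S(A)_{/k^al} = ∏ S_σ where S_σ ≈ Aut_{M_d(k^al)}(V₁) ≈ GL_{fg/d}(k^al)")] -/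
def Polarization.lefschetzGroupBaseChangeEquivBlocks (hE : H.endAlg = A.ι.range)
    (hτ : Injective τ) (hcard : Fintype.card S = finrank ℚ F)
    (hros : ∀ a v w, Q.form (A.ι a v) w = Q.form v (A.ι (σ a) w)) (hσ : ∀ a, σ (σ a) = a)
    (hκ : ∀ s, τ (κ s) = (τ s).comp (σ : F →ₐ[ℚ] F))
    (hΦ₁ : ∀ s, s ∈ Φ ∨ κ s ∈ Φ) (hΦ₂ : ∀ s ∈ Φ, κ s ∉ Φ) :
    letI : Module F V := Module.compHom V (A.ι : F →+* Module.End ℚ V)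
    haveI : IsScalarTower ℚ F V := A.isScalarTower_compHom
    Q.lefschetzGroupBaseChange K ≃*
      ∀ s : Φ, Deligne1982.weightSpace ℚ F K V τ s ≃ₗ[K] Deligne1982.weightSpace ℚ F K V τ s :=
  letI : Module F V := Module.compHom V (A.ι : F →+* Module.End ℚ V)
  haveI : IsScalarTower ℚ F V := A.isScalarTower_compHom
  (MulEquiv.subgroupCongr (Q.lefschetzGroupBaseChange_eq_formUnitaryGroup K A hE)).trans
    (Deligne1982.formUnitaryGroupEquiv τ (σ : F →ₐ[ℚ] F) κ Q.form Φ (traceForm_nondegenerate ℚ F) hros hτ hcard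
      hκ hσ Q.nondegenerate Q.form_swap_eq_negOnePow_mul hΦ₁ hΦ₂)

/-- The isomorphism IS restriction: `(equiv γ s) x = γ x` on `V_{K,τₛ}`. [cite: Milne1999LefschetzClasses, §2 Remark 2.2 (p. 647 L69 – p. 648 L5)] -/
theorem Polarization.coe_lefschetzGroupBaseChangeEquivBlocks_apply (hE : H.endAlg = A.ι.range)
    (hτ : Injective τ) (hcard : Fintype.card S = finrank ℚ F)
    (hros : ∀ a v w, Q.form (A.ι a v) w = Q.form v (A.ι (σ a) w)) (hσ : ∀ a, σ (σ a) = a)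
    (hκ : ∀ s, τ (κ s) = (τ s).comp (σ : F →ₐ[ℚ] F))
    (hΦ₁ : ∀ s, s ∈ Φ ∨ κ s ∈ Φ) (hΦ₂ : ∀ s ∈ Φ, κ s ∉ Φ) (γ : Q.lefschetzGroupBaseChange K) (s : Φ)
    (x : letI : Module F V := Module.compHom V (A.ι : F →+* Module.End ℚ V)
      haveI : IsScalarTower ℚ F V := A.isScalarTower_compHom
      Deligne1982.weightSpace ℚ F K V τ s) :
    letI : Module F V := Module.compHom V (A.ι : F →+* Module.End ℚ V)
    haveI : IsScalarTower ℚ F V := A.isScalarTower_compHom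
    ((Q.lefschetzGroupBaseChangeEquivBlocks K A τ σ κ Φ hE hτ hcard hros hσ hκ hΦ₁ hΦ₂ γ s x :
        Deligne1982.weightSpace ℚ F K V τ s) : K ⊗[ℚ] V) = (γ : (K ⊗[ℚ] V) ≃ₗ[K] (K ⊗[ℚ] V)) x := by
  letI : Module F V := Module.compHom V (A.ι : F →+* Module.End ℚ V)
  haveI : IsScalarTower ℚ F V := A.isScalarTower_compHom
  rfl

/-- **`S(H)(K) ≃* ∏_{s ∈ Φ} GL(V_{K,τₛ})` with the blocks typed as the tree's `EndAction.eigenspaceBaseChange K (τ s)`**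
(the same isomorphism, transported along `weightSpace = eigenspaceBaseChange`).
[cite: Milne1999LefschetzClasses, §2 Remark 2.2 (p. 647 L69 – p. 648 L5) and p. 651 L72–L81] -/
def Polarization.lefschetzGroupBaseChangeEquivEigenBlocks (hE : H.endAlg = A.ι.range)
    (hτ : Injective τ) (hcard : Fintype.card S = finrank ℚ F)
    (hros : ∀ a v w, Q.form (A.ι a v) w = Q.form v (A.ι (σ a) w)) (hσ : ∀ a, σ (σ a) = a)
    (hκ : ∀ s, τ (κ s) = (τ s).comp (σ : F →ₐ[ℚ] F))
    (hΦ₁ : ∀ s, s ∈ Φ ∨ κ s ∈ Φ) (hΦ₂ : ∀ s ∈ Φ, κ s ∉ Φ) :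
    Q.lefschetzGroupBaseChange K ≃*
      ∀ s : Φ, A.eigenspaceBaseChange K (τ s) ≃ₗ[K] A.eigenspaceBaseChange K (τ s) :=
  letI : Module F V := Module.compHom V (A.ι : F →+* Module.End ℚ V)
  haveI : IsScalarTower ℚ F V := A.isScalarTower_compHom
  (Q.lefschetzGroupBaseChangeEquivBlocks K A τ σ κ Φ hE hτ hcard hros hσ hκ hΦ₁ hΦ₂).trans
    (MulEquiv.piCongrRight fun s =>
      glConjMulEquiv (LinearEquiv.ofEq _ _ (A.weightSpace_eq_eigenspaceBaseChange K τ (s : S))))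

/-- The eigen-block isomorphism IS restriction: `(equiv γ s) x = γ x` on `V_{K,τₛ}`.
[cite: Milne1999LefschetzClasses, §2 Remark 2.2 (p. 647 L69 – p. 648 L5)] -/
@[simp] theorem Polarization.coe_lefschetzGroupBaseChangeEquivEigenBlocks_apply (hE : H.endAlg = A.ι.range)
    (hτ : Injective τ) (hcard : Fintype.card S = finrank ℚ F)
    (hros : ∀ a v w, Q.form (A.ι a v) w = Q.form v (A.ι (σ a) w)) (hσ : ∀ a, σ (σ a) = a)
    (hκ : ∀ s, τ (κ s) = (τ s).comp (σ : F →ₐ[ℚ] F))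
    (hΦ₁ : ∀ s, s ∈ Φ ∨ κ s ∈ Φ) (hΦ₂ : ∀ s ∈ Φ, κ s ∉ Φ) (γ : Q.lefschetzGroupBaseChange K) (s : Φ)
    (x : A.eigenspaceBaseChange K (τ s)) :
    ((Q.lefschetzGroupBaseChangeEquivEigenBlocks K A τ σ κ Φ hE hτ hcard hros hσ hκ hΦ₁ hΦ₂ γ s x :
        A.eigenspaceBaseChange K (τ s)) : K ⊗[ℚ] V) = (γ : (K ⊗[ℚ] V) ≃ₗ[K] (K ⊗[ℚ] V)) x :=
  rfl

/-- **Surjectivity, unbundled**: for `E_φ = ι(F)` as above, EVERY family of `K`-linear automorphisms of the blocks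
`V_{K,τₛ}`, `s ∈ Φ`, is the family of restrictions of a unique `γ ∈ S(H)(K)` (Milne: `S_σ ≈ GL(V₁)`).
[cite: Milne1999LefschetzClasses, §2 p. 651 L72–L81 and Remark 2.2 (p. 647 L69 – p. 648 L5)] -/
theorem Polarization.exists_unique_mem_lefschetzGroupBaseChange_restrict_eq (hE : H.endAlg = A.ι.range)
    (hτ : Injective τ) (hcard : Fintype.card S = finrank ℚ F)
    (hros : ∀ a v w, Q.form (A.ι a v) w = Q.form v (A.ι (σ a) w)) (hσ : ∀ a, σ (σ a) = a)
    (hκ : ∀ s, τ (κ s) = (τ s).comp (σ : F →ₐ[ℚ] F))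
    (hΦ₁ : ∀ s, s ∈ Φ ∨ κ s ∈ Φ) (hΦ₂ : ∀ s ∈ Φ, κ s ∉ Φ)
    (g : ∀ s : Φ, A.eigenspaceBaseChange K (τ s) ≃ₗ[K] A.eigenspaceBaseChange K (τ s)) :
    ∃! γ : Q.lefschetzGroupBaseChange K,
      ∀ (s : Φ) (x : A.eigenspaceBaseChange K (τ s)), (γ : (K ⊗[ℚ] V) ≃ₗ[K] (K ⊗[ℚ] V)) x = g s x := by
  set E := Q.lefschetzGroupBaseChangeEquivEigenBlocks K A τ σ κ Φ hE hτ hcard hros hσ hκ hΦ₁ hΦ₂ with hEdef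
  refine ⟨E.symm g, fun s x => ?_, fun γ hγ => ?_⟩
  · have h := congr_fun (E.apply_symm_apply g) s
    rw [← h]
    exact (Q.coe_lefschetzGroupBaseChangeEquivEigenBlocks_apply K A τ σ κ Φ hE hτ hcard hros hσ hκ hΦ₁ hΦ₂ _ s x).symm
  · rw [MulEquiv.eq_symm_apply]
    funext s
    refine LinearEquiv.ext fun x => Subtype.ext ?_
    rw [Q.coe_lefschetzGroupBaseChangeEquivEigenBlocks_apply K A τ σ κ Φ hE hτ hcard hros hσ hκ hΦ₁ hΦ₂]
    exact hγ s x

/-- **An element of `S(H)(K)` is determined by its blocks on a set of representatives `Φ`** (injectivity of restriction).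
[cite: Milne1999LefschetzClasses, §2 Remark 2.2 (p. 647 L69 – p. 648 L5)] -/
theorem Polarization.eq_of_forall_eqOn_eigenspaceBaseChange (hE : H.endAlg = A.ι.range)
    (hτ : Injective τ) (hcard : Fintype.card S = finrank ℚ F)
    (hros : ∀ a v w, Q.form (A.ι a v) w = Q.form v (A.ι (σ a) w)) (hσ : ∀ a, σ (σ a) = a)
    (hκ : ∀ s, τ (κ s) = (τ s).comp (σ : F →ₐ[ℚ] F)) (hΦ₁ : ∀ s, s ∈ Φ ∨ κ s ∈ Φ)
    {γ δ : (K ⊗[ℚ] V) ≃ₗ[K] (K ⊗[ℚ] V)} (hγ : γ ∈ Q.lefschetzGroupBaseChange K)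
    (hδ : δ ∈ Q.lefschetzGroupBaseChange K)
    (h : ∀ s ∈ Φ, ∀ x ∈ A.eigenspaceBaseChange K (τ s), γ x = δ x) : γ = δ := by
  letI : Module F V := Module.compHom V (A.ι : F →+* Module.End ℚ V)
  haveI : IsScalarTower ℚ F V := A.isScalarTower_compHom
  rw [Q.lefschetzGroupBaseChange_eq_formUnitaryGroup K A hE] at hγ hδ
  refine Deligne1982.eq_of_eqOn_weightSpace Q.form τ κ (σ : F →ₐ[ℚ] F) (traceForm_nondegenerate ℚ F) hros hτ hcard
    hκ hσ Q.nondegenerate Φ hΦ₁ hγ hδ fun s hs x hx => h s hs x ?_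
  rwa [A.weightSpace_eq_eigenspaceBaseChange K τ s] at hx

/-- **`γ|V_{K,τₛ}` determines `γ|V_{K,τₛ∘σ}`** for `γ ∈ S(H)(K)` ("the representation on `V₂` is the contragredient of
the standard representation": the partner block is the dual-inverse). [cite: Milne1999LefschetzClasses, §2 Remark 2.2 (p. 647 L69 – p. 648 L7) and p. 651 L79–L81 ("d copies of the standard representation … and d copies of its contragredient")] -/
theorem Polarization.eqOn_eigenspaceBaseChange_comp_of_eqOn (hE : H.endAlg = A.ι.range)
    (hτ : Injective τ) (hcard : Fintype.card S = finrank ℚ F)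
    (hros : ∀ a v w, Q.form (A.ι a v) w = Q.form v (A.ι (σ a) w)) (hσ : ∀ a, σ (σ a) = a)
    (hκ : ∀ s, τ (κ s) = (τ s).comp (σ : F →ₐ[ℚ] F)) {s : S}
    {γ δ : (K ⊗[ℚ] V) ≃ₗ[K] (K ⊗[ℚ] V)} (hγ : γ ∈ Q.lefschetzGroupBaseChange K)
    (hδ : δ ∈ Q.lefschetzGroupBaseChange K)
    (h : ∀ x ∈ A.eigenspaceBaseChange K (τ s), γ x = δ x) :
    ∀ y ∈ A.eigenspaceBaseChange K ((τ s).comp (σ : F →ₐ[ℚ] F)), γ y = δ y := by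
  letI : Module F V := Module.compHom V (A.ι : F →+* Module.End ℚ V)
  haveI : IsScalarTower ℚ F V := A.isScalarTower_compHom
  rw [Q.lefschetzGroupBaseChange_eq_formUnitaryGroup K A hE] at hγ hδ
  intro y hy
  rw [← hκ, ← A.weightSpace_eq_eigenspaceBaseChange K τ (κ s)] at hy
  refine Deligne1982.eqOn_weightSpace_ι_of_eqOn Q.form τ κ (σ : F →ₐ[ℚ] F) (traceForm_nondegenerate ℚ F) hros hτ
    hcard hκ hσ Q.nondegenerate hγ hδ (fun x hx => h x ?_) y hy
  rwa [A.weightSpace_eq_eigenspaceBaseChange K τ s] at hx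

/-- **Paired blocks have equal dimension**: `dim_K V_{K,χ} = dim_K V_{K,χ∘σ}` (`V₂ = V₁^∨`).
[cite: Milne1999LefschetzClasses, §2 Remark 2.2 (p. 647 L48 – p. 648 L7) and p. 650 L72 ("Let V₂ = V₁^∨")] -/
theorem EndAction.finrank_eigenspaceBaseChange_eq_finrank_eigenspaceBaseChange_comp
    (hτ : Injective τ) (hcard : Fintype.card S = finrank ℚ F)
    (hros : ∀ a v w, Q.form (A.ι a v) w = Q.form v (A.ι (σ a) w)) (hσ : ∀ a, σ (σ a) = a)
    (hκ : ∀ s, τ (κ s) = (τ s).comp (σ : F →ₐ[ℚ] F)) (s : S) :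
    finrank K (A.eigenspaceBaseChange K (τ s)) = finrank K (A.eigenspaceBaseChange K ((τ s).comp (σ : F →ₐ[ℚ] F))) := by
  letI : Module F V := Module.compHom V (A.ι : F →+* Module.End ℚ V)
  haveI : IsScalarTower ℚ F V := A.isScalarTower_compHom
  rw [← hκ, ← A.weightSpace_eq_eigenspaceBaseChange K τ s, ← A.weightSpace_eq_eigenspaceBaseChange K τ (κ s)]
  exact Deligne1982.finrank_weightSpace_eq_finrank_weightSpace_ι τ (σ : F →ₐ[ℚ] F) κ Q.form
    (traceForm_nondegenerate ℚ F) hros hτ hcard hκ hσ Q.nondegenerate s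

/-- **The paired blocks are `Q_K`-isotropic and in perfect duality**: `Q_K|V_{K,χ} × V_{K,χ} = 0` when `χ ∘ σ ≠ χ`, and
`Q_K : V_{K,χ} × V_{K,χ∘σ} → K` is a perfect pairing ("`φ|V₁ × V₁ = 0 = φ|V₂ × V₂`, and there is a nondegenerate
`Ω`-bilinear form `φ₁ : V₁ × V₂ → Ω`"). [cite: Milne1999LefschetzClasses, §2 Remark 2.2 (p. 647 L48 – p. 648 L7)] -/
theorem Polarization.isPerfPair_baseChange_form_eigenspaceBaseChange
    (hτ : Injective τ) (hcard : Fintype.card S = finrank ℚ F)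
    (hros : ∀ a v w, Q.form (A.ι a v) w = Q.form v (A.ι (σ a) w)) (hσ : ∀ a, σ (σ a) = a)
    (hκ : ∀ s, τ (κ s) = (τ s).comp (σ : F →ₐ[ℚ] F)) (s : S) :
    LinearMap.IsPerfPair (R := K) (M := A.eigenspaceBaseChange K (τ s))
      (N := A.eigenspaceBaseChange K ((τ s).comp (σ : F →ₐ[ℚ] F)))
      ((Q.form.baseChange K).compl₁₂ (A.eigenspaceBaseChange K (τ s)).subtype
        (A.eigenspaceBaseChange K ((τ s).comp (σ : F →ₐ[ℚ] F))).subtype) := by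
  letI : Module F V := Module.compHom V (A.ι : F →+* Module.End ℚ V)
  haveI : IsScalarTower ℚ F V := A.isScalarTower_compHom
  have h := Deligne1982.isPerfPair_weightPairing τ (σ : F →ₐ[ℚ] F) κ Q.form (traceForm_nondegenerate ℚ F) hros hτ
    hcard hκ hσ Q.nondegenerate s
  rw [Deligne1982.weightPairing, A.weightSpace_eq_eigenspaceBaseChange K τ s,
    A.weightSpace_eq_eigenspaceBaseChange K τ (κ s), hκ] at h
  exact h

end Splitting

end HodgeStructure

end Literature.AlgebraicGeometry.Motives
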